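import Summits.NavierStokesRegularity.FluidComputer.GateBudgetSwingFloorPrice
import Summits.NavierStokesRegularity.FluidComputer.GateBudgetDudCeiling
import HarnessLib

/-!
# GateBudget part 113 — the swing transfer from below, V: the dud ceiling re-counted (§300–§301)

Cell `pub-fluidc`, blueprint seat bp1 (gen 39, eighth item); namespace
`Summit.NavierStokesRegularity.FluidComputer.GateBudget`, headline family
`RotorKnob.rotorCircuit K K¹⁰ ε ρ` (modes `0 = a` carrier, `1 = b` clock, `2 = c` trigger,
`3 = d` transfer, `4 = ã` output) from `delayInit`, trigger primitive `C` (`C' = c`), on the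
UNIT lattice `ε = K¹⁰ρ²`. Imports part 112 (`GateBudgetSwingFloorPrice`: the headline swing
floor; through it parts 100–111) and part 72 (`GateBudgetDudCeiling`: the dud ceiling
`N ≤ K⁹/7 + 1`; through it part 61 §190 `knob_pulse_exit`).
HONEST FRAMING: a low prior, high value-of-information experiment on Tao's machine paradigm;
NOT a claim that NS blows up. Nothing here is about the Navier–Stokes equations.

THE POINT (SPEC-INPUT-bp1 §CI(3)(b); the necessity side of the swing law, fifth and last file).
Part 72 §218 says: a normal-form ignition (`b(r) = θε`, `5/4 ≤ θ ≤ 3/2`, `c(r) = ρ²/K⁹`) with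
small output pair `d(r)² + ã(r)² ≤ 1/50` is followed by a pulse `[r, T']`, `T' - r ≤ 242/K⁹`,
across which the output climbs by AT LEAST `1/K⁹` (part 71's crude leak law), whence §219: ANY
run of such ignitions separated by a pulse length has at most `K⁹/7 + 1` members. This file
re-counts with the swing floor. (§300) If in addition the transfer mode is SMALL at ignition,
`|d(r)| ≤ 10⁻³` (the clean misfire ladder of parts 97/107 has `|d(rₙ)| ≤ D ≈ 4·10⁻⁶`), then on
the unit lattice the same pulse (part 61 §190: kept ring, `c > 0`, exit `b(T') = -θ'ε`,
`θ' ≥ θ - 243/K⁹ ≥ (31/32)θ`) carries part 100 §277's headline band `r < t₁ < t₂ ≤ T'`, and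
part 112 §299(a) prices its swing from below: `ã(T') - ã(r) ≥ ã(t₂) - ã(t₁)
≥ (999/1000)·(a(r)²/(θK⁹))·(1.916 - 4.16E)` with `E·a(r)² = |d(r)| + d(r)² + 6L(T' - r)
≤ 10⁻³ + 10⁻⁶ + 10⁻⁴` (`L = ε + ρ²e^{-K¹⁰} + Kã(T') ≤ 1.1K`, `K(T' - r) ≤ 242/K⁸`) and
`a(r)² = 1 - (b² + c²) - (d² + ã²) ≥ 49/50 - 10⁻⁶` (energy sphere): THE RUNG LEAKS AT LEAST
`1.87/(θK⁹)` — `≥ 1.246/K⁹` at `θ ≤ 3/2`, `≥ 1.289/K⁹` at `θ ≤ 29/20`, against `1/K⁹`.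
(§301) THE DUD CEILING RE-COUNTED: any run `r₀ < r₁ < …` of such ignitions (pulse-separated,
`θₙ ∈ [5/4, Θ]`, `Θ ≤ 3/2`, `|d(rₙ)| ≤ 10⁻³`) has `N ≤ ΘK⁹/(7·1.87) + 1` members —
`0.1146K⁹ + 1` at `Θ = 3/2`, `0.1108K⁹ + 1` at `Θ = 29/20` (the ladder's normal form) — against
part 72's `K⁹/7 + 1 = 0.1429K⁹ + 1`; with part 108's `0.0656K⁹` clean rungs certified from the
other side, the clean dud horizon of the small-transfer ladder at `k = 1` lies in
`[0.0656K⁹, 0.1108K⁹ + 1]`, a factor `1.69` (parts 98/72: `4.1`; parts 108/72: `2.16`).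

* §300 `knob_rung_leak_swing` (THE RUNG LEAK WITH THE SWING FLOOR: `∃ T'`, `r < T'`,
  `T' - r ≤ 242/K⁹`, `ã(T') ≥ ã(r) + 1.87/(θK⁹)`); `knob_rung_leak_swing_after` (every
  `t ≥ r + 242/K⁹` inherits it).
* §301 `knob_dud_ceiling_swing` (THE DUD CEILING RE-COUNTED: `N ≤ ΘK⁹/(7·1.87) + 1`).

NUMBERS. `0.999·(1.916·(49/50 - 10⁻⁶) - 4.16·(10⁻³ + 10⁻⁶ + 10⁻⁴)) = 0.999·(1.87768 - 0.00458)
= 1.87122 ≥ 1.87`; `6L(T' - r) ≤ 6.6·242/2³² = 3.7·10⁻⁷ ≤ 10⁻⁴`; `243/K⁹ ≤ 243/2³⁶ ≤ θ/32`;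
`1/(7·1.87) = 0.07639`: `Θ = 3/2 ↦ 0.1146`, `Θ = 29/20 ↦ 0.1108`, `Θ = 5/4 ↦ 0.0955`.
HONEST LIMITS. (i) The re-count needs `|d(rₙ)| ≤ 10⁻³` — part 72 §219 does NOT (its `1/K⁹`
holds for any `d(r)² + ã(r)² ≤ 1/50`): the crude lock's drift `E` charges `|d(r)|` linearly, so
for `|d(r)| ≳ 0.03` part 71's floor is the better one and `K⁹/7 + 1` remains the ceiling for
general clean runs; the sharper `0.11K⁹` is a statement about SMALL-TRANSFER clean runs, the
class the ladder of parts 97/107/108 lives in; (ii) `k = 1` (unit lattice) only; (iii) like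
§219 this bounds the NUMBER of clean small-pair ignitions, not the time to fire, and claims
nothing about what the member does afterwards; (iv) the two-sided window is quoted, not
re-proved here (part 108 is a separate file with the ladder's hypotheses); (v) nothing about NS.
[cite: Tao2016AveragedNS, §5.5 Theorem 5.3, (5.5), (5.6), (b-eq), (c-eq), (d-eq), (ta-eq),
(energy-con)]
-/

noncomputable section

namespace Summit.NavierStokesRegularity.FluidComputer.GateBudget

open Real Set Filter Topology
open Literature.Analysis.FluidPDE.Tao2016AveragedNS

variable {K M ε ρ : ℝ} {X : ℝ → Fin 5 → ℝ} {C : ℝ → ℝ}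

/-! ## §300 The rung leak with the swing floor -/

/-- §300 THE RUNG LEAK WITH THE SWING FLOOR (headline member from `delayInit` with a trigger
primitive `C`; `K ≥ 16`, `0 < ε`, `ε² ≤ 1/(6K²⁰)`, `0 < ρ`, UNIT LATTICE `ε = K¹⁰ρ²`; an
ignition `r ≥ 0` in normal form `b(r) = θε`, `5/4 ≤ θ ≤ 3/2`, `c(r) = ρ²/K⁹`, with small
output pair `d(r)² + ã(r)² ≤ 1/50` AND small transfer `|d(r)| ≤ 10⁻³`). Then the pulse of
part 61 §190 (`r < T'`, `T' - r ≤ 242/K⁹`) ends with `ã(T') ≥ ã(r) + 1.87/(θK⁹)` (part 72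
§218: `+ 1/K⁹`): the exit `b(T') = -θ'ε`, `θ' ≥ θ - 243/K⁹ ≥ (31/32)θ` feeds part 100 §277,
whose band `[t₁, t₂] ⊆ (r, T']` part 112 §299(a) prices from below; `a(r)² ≥ 49/50 - 10⁻⁶`
by the energy sphere (`b(r)² + c(r)² ≤ 10⁻⁶`), `E·a(r)² ≤ 10⁻³ + 10⁻⁶ + 10⁻⁴`, and `ã` is
monotone outside the band.
[derived: part 61 §190, part 100 §277, part 112 §299(a); RotorKnob (`traj_sum_sq_eq_one`,
`rotorCircuit_output_monotone`); Tao2016AveragedNS (5.6)] -/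
theorem knob_rung_leak_swing
    (hX : ∀ t, HasDerivAt X (RotorKnob.rotorCircuit K (K ^ 10) ε ρ (X t)) t)
    (h0 : X 0 = delayInit) (hC : ∀ t, HasDerivAt C (X t 2) t) (hK : 16 ≤ K) (hε : 0 < ε)
    (hεK : ε ^ 2 ≤ 1 / (6 * K ^ 20)) (hρ : 0 < ρ) (hlat : ε = K ^ 10 * ρ ^ 2) {r θ : ℝ}
    (hr : 0 ≤ r) (hθ1 : 5 / 4 ≤ θ) (hθ2 : θ ≤ 3 / 2) (hbr : X r 1 = θ * ε)
    (hcr : X r 2 = ρ ^ 2 / K ^ 9) (hPr : X r 3 ^ 2 + X r 4 ^ 2 ≤ 1 / 50)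
    (hd : |X r 3| ≤ 1 / 1000) :
    ∃ T' : ℝ, r < T' ∧ T' - r ≤ 242 / K ^ 9 ∧ X r 4 + 187 / 100 / (θ * K ^ 9) ≤ X T' 4 := by
  have hK0 : (0 : ℝ) < K := by linarith
  have hK1 : (1 : ℝ) ≤ K := by linarith
  have hθ0 : (0 : ℝ) < θ := by linarith
  have hK8 : (2 : ℝ) ^ 32 ≤ K ^ 8 := by
    calc (2 : ℝ) ^ 32 = 16 ^ 8 := by norm_num
      _ ≤ K ^ 8 := pow_le_pow_left₀ (by norm_num) hK 8
  have hK9 : (2 : ℝ) ^ 36 ≤ K ^ 9 := by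
    calc (2 : ℝ) ^ 36 = 16 ^ 9 := by norm_num
      _ ≤ K ^ 9 := pow_le_pow_left₀ (by norm_num) hK 9
  have hK10 : (2 : ℝ) ^ 40 ≤ K ^ 10 := by
    calc (2 : ℝ) ^ 40 = 16 ^ 10 := by norm_num
      _ ≤ K ^ 10 := pow_le_pow_left₀ (by norm_num) hK 10
  have hK9pos : (0 : ℝ) < K ^ 9 := by positivity
  have hK10pos : (0 : ℝ) < K ^ 10 := by positivity
  -- the unit lattice inside part 61's window
  have hKρ0 : 0 ≤ K ^ 10 * ρ ^ 2 := by positivity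
  have hhi : K ^ 10 * ρ ^ 2 ≤ 2 * ε := by rw [hlat]; linarith only [hKρ0]
  have hρ2 : ρ ^ 2 = ε / K ^ 10 := by rw [eq_div_iff hK10pos.ne', hlat]; ring
  have hlo : 200 * ε / K ^ 20 ≤ ρ ^ 2 := by
    rw [hρ2, div_le_div_iff₀ (by positivity) hK10pos]
    have h20 : (200 : ℝ) * K ^ 10 ≤ K ^ 20 := by
      rw [show K ^ 20 = K ^ 10 * K ^ 10 by ring]
      exact mul_le_mul_of_nonneg_right (le_trans (by norm_num) hK10) hK10pos.le
    calc 200 * ε * K ^ 10 = ε * (200 * K ^ 10) := by ring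
      _ ≤ ε * K ^ 20 := mul_le_mul_of_nonneg_left h20 hε.le
  -- (1) the pulse (part 61 §190) and its exit below the band edge
  obtain ⟨T', θ', hrT, hτ, hpos, -, -, -, hbT, hθ'lo, -, hkept, -⟩ :=
    knob_pulse_exit hX h0 hK hε hρ hlo hhi hr hθ1 hθ2 hbr hcr
  have h243 : 243 / K ^ 9 ≤ 243 / 2 ^ 36 :=
    div_le_div_of_nonneg_left (by norm_num) (by positivity) hK9
  have hbT' : X T' 1 ≤ -(31 / 32 * θ * ε) := by
    rw [hbT]
    have h : 31 / 32 * θ ≤ θ' := by linarith only [hθ'lo, h243, hθ1]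
    nlinarith only [h, hε]
  -- (2) the band (part 100 §277)
  obtain ⟨t₁, t₂, hrt₁, ht₁₂, ht₂T, hb1, hb2, -, hband, -, hring, -, -, -, hdlo, hdhi⟩ :=
    pulse_swing_band hX h0 hC hK hε hρ hhi hrT.le hτ hθ1 hbr hcr hkept hpos hbT'
  -- (3) the entry data: `b(r)² + c(r)² ≤ 10⁻⁶`, `a(r)² ≥ 49/50 - 10⁻⁶` (part 72 §218 verbatim)
  have hρε : ρ ^ 2 ≤ 2 * ε / K ^ 10 := by
    rw [le_div_iff₀ hK10pos]
    linarith only [hhi]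
  have hc1 : ρ ^ 2 / K ^ 9 ≤ ε / 10 ^ 3 := by
    have e1 : ρ ^ 2 / K ^ 9 ≤ ρ ^ 2 := div_le_self (by positivity) (one_le_pow₀ hK1)
    have e3 : 2 * ε / K ^ 10 ≤ 2 * ε / 2 ^ 40 :=
      div_le_div_of_nonneg_left (by positivity) (by positivity) hK10
    have e4 : 2 * ε / 2 ^ 40 ≤ ε / 10 ^ 3 := by
      rw [div_le_div_iff₀ (by positivity) (by positivity)]
      linarith only [hε]
    linarith only [e1, hρε, e3, e4]
  have hc2 : (ρ ^ 2 / K ^ 9) ^ 2 ≤ ε ^ 2 / 10 ^ 6 := by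
    calc (ρ ^ 2 / K ^ 9) ^ 2 ≤ (ε / 10 ^ 3) ^ 2 := pow_le_pow_left₀ (by positivity) hc1 2
      _ = ε ^ 2 / 10 ^ 6 := by rw [div_pow]; norm_num
  have hbc : X r 1 ^ 2 + X r 2 ^ 2 ≤ 1 / 10 ^ 6 := by
    rw [hbr, hcr]
    have e1 : (θ * ε) ^ 2 ≤ (9 / 4) * ε ^ 2 := by
      rw [mul_pow]
      exact mul_le_mul_of_nonneg_right (by nlinarith only [hθ1, hθ2]) (sq_nonneg ε)
    have hK20 : (2 : ℝ) ^ 80 ≤ K ^ 20 := by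
      calc (2 : ℝ) ^ 80 = 16 ^ 20 := by norm_num
        _ ≤ K ^ 20 := pow_le_pow_left₀ (by norm_num) hK 20
    have e2 : ε ^ 2 ≤ 1 / (6 * 2 ^ 40) :=
      hεK.trans (div_le_div_of_nonneg_left (by norm_num) (by positivity)
        (by linarith only [hK20]))
    nlinarith only [e1, e2, hc2]
  have hA : 49 / 50 - 1 / 10 ^ 6 ≤ X r 0 ^ 2 := by
    have hEq := RotorKnob.traj_sum_sq_eq_one hX h0 r
    linarith only [hEq, hbc, hPr]
  have ha : X r 0 ≠ 0 := by
    intro h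
    rw [h] at hA
    norm_num at hA
  -- (4) the floor on the band (part 112 §299(a)) and the monotone output outside it
  obtain ⟨E, hE⟩ : ∃ E : ℝ,
      E = (|X r 3| + X r 3 ^ 2 + 6 * (ε + ρ ^ 2 * exp (-K ^ 10) + K * X T' 4) * (T' - r))
        / X r 0 ^ 2 := ⟨_, rfl⟩
  have hfl := swing_headline_floor hX h0 hC hK hε hlat hr hrt₁.le ht₁₂.le ht₂T hτ hθ1 ha hcr
    hring hpos hb1 hb2 hband hdlo hdhi hE
  have hm1 : X r 4 ≤ X t₁ 4 := RotorKnob.rotorCircuit_output_monotone hK0.le hX hrt₁.le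
  have hm2 : X t₂ 4 ≤ X T' 4 := RotorKnob.rotorCircuit_output_monotone hK0.le hX ht₂T
  refine ⟨T', hrT, hτ, ?_⟩
  -- (5) the numerics: `E·a(r)² = |d(r)| + d(r)² + 6L(T' - r) ≤ 10⁻³ + 10⁻⁶ + 10⁻⁴`
  have hd2 : X r 3 ^ 2 ≤ (1 / 1000) ^ 2 := by
    rw [← sq_abs (X r 3)]; exact pow_le_pow_left₀ (abs_nonneg _) hd 2
  have hε1 : ε ≤ 4 / 5 := by
    have hb := (abs_le.1 (RotorKnob.traj_abs_le_one hX h0 r 1)).2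
    rw [hbr] at hb
    nlinarith only [hb, hθ1, hε]
  have hρε' : ρ ^ 2 ≤ ε := by
    rw [hlat]; nlinarith only [one_le_pow₀ hK1 (n := 10), sq_nonneg ρ]
  have hexp1 : exp (-K ^ 10) ≤ 1 := exp_le_one_iff.2 (by simp [pow_nonneg hK0.le])
  have heT : X T' 4 ≤ 1 := (abs_le.1 (RotorKnob.traj_abs_le_one hX h0 T' 4)).2
  have heT0 : 0 ≤ X T' 4 := RotorKnob.e_nonneg hX h0 hK0.le (hr.trans hrT.le)
  have hL : ε + ρ ^ 2 * exp (-K ^ 10) + K * X T' 4 ≤ 11 / 10 * K := by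
    have h1 : ρ ^ 2 * exp (-K ^ 10) ≤ ρ ^ 2 := mul_le_of_le_one_right (sq_nonneg ρ) hexp1
    have h2 : K * X T' 4 ≤ K := mul_le_of_le_one_right hK0.le heT
    linarith only [h1, h2, hε1, hρε', hK]
  have hL0 : 0 ≤ ε + ρ ^ 2 * exp (-K ^ 10) + K * X T' 4 := by positivity
  have hτ0 : 0 ≤ T' - r := by linarith only [hrT]
  have hKτ : K * (T' - r) ≤ 242 / 2 ^ 32 := by
    have h1 : K * (T' - r) * K ^ 8 ≤ 242 := by
      rw [show K * (T' - r) * K ^ 8 = (T' - r) * K ^ 9 by ring]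
      exact (le_div_iff₀ hK9pos).1 hτ
    rw [le_div_iff₀ (by positivity)]
    exact (mul_le_mul_of_nonneg_left hK8 (by positivity)).trans h1
  have h6L : 6 * (ε + ρ ^ 2 * exp (-K ^ 10) + K * X T' 4) * (T' - r) ≤ 1 / 10 ^ 4 := by
    calc 6 * (ε + ρ ^ 2 * exp (-K ^ 10) + K * X T' 4) * (T' - r)
        ≤ 6 * (11 / 10 * K) * (T' - r) :=
          mul_le_mul_of_nonneg_right (mul_le_mul_of_nonneg_left hL (by norm_num)) hτ0
      _ = 66 / 10 * (K * (T' - r)) := by ring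
      _ ≤ 66 / 10 * (242 / 2 ^ 32) := mul_le_mul_of_nonneg_left hKτ (by norm_num)
      _ ≤ 1 / 10 ^ 4 := by norm_num
  have hEa : E * X r 0 ^ 2
      = |X r 3| + X r 3 ^ 2 + 6 * (ε + ρ ^ 2 * exp (-K ^ 10) + K * X T' 4) * (T' - r) := by
    rw [hE]; exact div_mul_cancel₀ _ (pow_ne_zero 2 ha)
  have key : 187 / 100 / (θ * K ^ 9)
      ≤ 999 / 1000 * X r 0 ^ 2 / (θ * K ^ 9) * (1916 / 1000 - 416 / 100 * E) := by
    have e : 999 / 1000 * X r 0 ^ 2 / (θ * K ^ 9) * (1916 / 1000 - 416 / 100 * E)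
        = 999 / 1000 * (1916 / 1000 * X r 0 ^ 2 - 416 / 100 * (E * X r 0 ^ 2)) / (θ * K ^ 9) := by
      ring
    rw [e]
    refine div_le_div_of_nonneg_right ?_ (by positivity)
    rw [hEa]
    linarith only [hA, hd, hd2, h6L]
  linarith only [hfl, key, hm1, hm2]

/-- §300 THE RUNG LEAK WITH THE SWING FLOOR, after the pulse: in the setting of
`knob_rung_leak_swing`, `ã(t) ≥ ã(r) + 1.87/(θK⁹)` for every `t ≥ r + 242/K⁹` (the output is
non-decreasing). [derived: this file §300; RotorKnob `rotorCircuit_output_monotone`] -/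
theorem knob_rung_leak_swing_after
    (hX : ∀ t, HasDerivAt X (RotorKnob.rotorCircuit K (K ^ 10) ε ρ (X t)) t)
    (h0 : X 0 = delayInit) (hC : ∀ t, HasDerivAt C (X t 2) t) (hK : 16 ≤ K) (hε : 0 < ε)
    (hεK : ε ^ 2 ≤ 1 / (6 * K ^ 20)) (hρ : 0 < ρ) (hlat : ε = K ^ 10 * ρ ^ 2) {r θ : ℝ}
    (hr : 0 ≤ r) (hθ1 : 5 / 4 ≤ θ) (hθ2 : θ ≤ 3 / 2) (hbr : X r 1 = θ * ε)
    (hcr : X r 2 = ρ ^ 2 / K ^ 9) (hPr : X r 3 ^ 2 + X r 4 ^ 2 ≤ 1 / 50)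
    (hd : |X r 3| ≤ 1 / 1000) {t : ℝ} (ht : r + 242 / K ^ 9 ≤ t) :
    X r 4 + 187 / 100 / (θ * K ^ 9) ≤ X t 4 := by
  obtain ⟨T', -, hτ, hleak⟩ :=
    knob_rung_leak_swing hX h0 hC hK hε hεK hρ hlat hr hθ1 hθ2 hbr hcr hPr hd
  have hK0 : (0 : ℝ) ≤ K := by linarith
  have hmono := RotorKnob.rotorCircuit_output_monotone hK0 hX
    (show T' ≤ t by linarith only [hτ, ht])
  exact hleak.trans hmono

/-! ## §301 The dud ceiling re-counted -/

/-- §301 THE DUD CEILING RE-COUNTED (part 72 §219 with the swing floor). Headline member from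
`delayInit` with a trigger primitive `C`, `K ≥ 16`, `0 < ε`, `ε² ≤ 1/(6K²⁰)`, `0 < ρ`, UNIT
LATTICE `ε = K¹⁰ρ²`. Let `r₀, …, r_{N-1}` be ANY times with `r₀ ≥ 0` and
`r_{n+1} ≥ r_n + 242/K⁹`, each a normal-form ignition `b(r_n) = θ_nε`, `5/4 ≤ θ_n ≤ Θ`
(`5/4 ≤ Θ ≤ 3/2`), `c(r_n) = ρ²/K⁹`, with small output pair `d(r_n)² + ã(r_n)² ≤ 1/50` and small
transfer `|d(r_n)| ≤ 10⁻³`. Then `N ≤ ΘK⁹/(7·1.87) + 1` (`= 0.1146K⁹ + 1` at `Θ = 3/2`,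
`0.1108K⁹ + 1` at `Θ = 29/20`; part 72: `K⁹/7 + 1 = 0.1429K⁹ + 1`): by §300 the output climbs
`≥ 1.87/(ΘK⁹)` from each ignition to the next, starts `≥ 0` and is `≤ 1/7` at the last one.
With part 108's `0.0656K⁹` clean rungs from below, the clean dud horizon of the small-transfer
ladder at `k = 1` lies in `[0.0656K⁹, 0.1108K⁹ + 1]`.
[derived: this file §300; part 72 §219 (the count); Tao2016AveragedNS (5.6)] -/
theorem knob_dud_ceiling_swing
    (hX : ∀ t, HasDerivAt X (RotorKnob.rotorCircuit K (K ^ 10) ε ρ (X t)) t)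
    (h0 : X 0 = delayInit) (hC : ∀ t, HasDerivAt C (X t 2) t) (hK : 16 ≤ K) (hε : 0 < ε)
    (hεK : ε ^ 2 ≤ 1 / (6 * K ^ 20)) (hρ : 0 < ρ) (hlat : ε = K ^ 10 * ρ ^ 2) {Θ : ℝ}
    (hΘ1 : 5 / 4 ≤ Θ) (hΘ2 : Θ ≤ 3 / 2) {N : ℕ} {r θ : ℕ → ℝ} (hr0 : 0 ≤ r 0)
    (hsep : ∀ n, n + 1 < N → r n + 242 / K ^ 9 ≤ r (n + 1))
    (hθ : ∀ n, n < N → 5 / 4 ≤ θ n ∧ θ n ≤ Θ) (hb : ∀ n, n < N → X (r n) 1 = θ n * ε)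
    (hc : ∀ n, n < N → X (r n) 2 = ρ ^ 2 / K ^ 9)
    (hP : ∀ n, n < N → X (r n) 3 ^ 2 + X (r n) 4 ^ 2 ≤ 1 / 50)
    (hd : ∀ n, n < N → |X (r n) 3| ≤ 1 / 1000) :
    (N : ℝ) ≤ Θ * K ^ 9 / (7 * (187 / 100)) + 1 := by
  have hK0 : (0 : ℝ) < K := by linarith
  have hK9 : (0 : ℝ) < K ^ 9 := by positivity
  have hΘ0 : 0 < Θ := by linarith only [hΘ1]
  have hΘK : 0 < Θ * K ^ 9 := by positivity
  rcases Nat.eq_zero_or_pos N with hN | hN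
  · rw [hN, Nat.cast_zero]
    positivity
  have claim : ∀ n, n < N → 0 ≤ r n ∧ X (r 0) 4 + n * (187 / 100) / (Θ * K ^ 9) ≤ X (r n) 4 := by
    intro n
    induction n with
    | zero =>
      intro _
      exact ⟨hr0, by rw [Nat.cast_zero, zero_mul, zero_div, add_zero]⟩
    | succ m ih =>
      intro hm
      have hm' : m < N := Nat.lt_of_succ_lt hm
      obtain ⟨hrm, hout⟩ := ih hm'
      have hs := hsep m hm
      obtain ⟨hθlo, hθhi⟩ := hθ m hm'
      have hleak := knob_rung_leak_swing_after hX h0 hC hK hε hεK hρ hlat hrm hθlo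
        (hθhi.trans hΘ2) (hb m hm') (hc m hm') (hP m hm') (hd m hm') hs
      have hθ0 : 0 < θ m := by linarith only [hθlo]
      have hcmp : 187 / 100 / (Θ * K ^ 9) ≤ 187 / 100 / (θ m * K ^ 9) :=
        div_le_div_of_nonneg_left (by norm_num) (by positivity)
          (mul_le_mul_of_nonneg_right hθhi hK9.le)
      refine ⟨?_, ?_⟩
      · have : (0 : ℝ) ≤ 242 / K ^ 9 := by positivity
        linarith only [hrm, hs, this]
      · rw [Nat.cast_succ, add_mul, one_mul, add_div]
        linarith only [hout, hleak, hcmp]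
  have hlast : N - 1 < N := Nat.sub_lt hN Nat.one_pos
  obtain ⟨-, hout⟩ := claim (N - 1) hlast
  have he0 : 0 ≤ X (r 0) 4 := RotorKnob.e_nonneg hX h0 hK0.le hr0
  have heN : X (r (N - 1)) 4 ≤ 1 / 7 := by
    have h := hP (N - 1) hlast
    nlinarith only [h, sq_nonneg (X (r (N - 1)) 3), sq_nonneg (X (r (N - 1)) 4 - 1 / 7)]
  have hcast : ((N - 1 : ℕ) : ℝ) = N - 1 := by
    rw [Nat.cast_sub hN, Nat.cast_one]
  rw [hcast] at hout
  have h1 : ((N : ℝ) - 1) * (187 / 100) / (Θ * K ^ 9) ≤ 1 / 7 := by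
    linarith only [hout, he0, heN]
  rw [div_le_iff₀ hΘK] at h1
  rw [div_add_one (by norm_num : (7 * (187 / 100) : ℝ) ≠ 0), le_div_iff₀ (by norm_num)]
  linarith only [h1]

end Summit.NavierStokesRegularity.FluidComputer.GateBudget
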